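import Summits.HodgeConjecture.HodgeConjecture.Theorems.F0P3StubE2pFold                -- ★ (p03 g3 ∕ p01 g4 ed.2): `hodgeTypeRigid_of_cohArchComponentRigid_cpt`'s inputs
import HarnessLib

/-!
# Crux `H413` — CONTRACT v6 fold K1: letter E2′ `hodgeTypeRigid` from **β_opp** (the CONSUMED INSTANCE of β) + `StubF1aCM`[v5]

Floor-0 programme P3 «U3-mult», seat F0P3-p01 (g4); crux item stmt-HodgeConjecture-24833 (`HCCMUnconditional.H413`); F0P3-plan (g3) RULING (K)
(2026-08-31T04:44Z), sketch `F0/P3/F0P3-plan/CONTRACT-v6-StubBetaOpp.F0P3g3.lean` (sha16 3f20d2eba743c10c).  HC_CM is proved only modulo the printed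
citations until rung 0 closes.

FINDING (planner, tree-read): the E2′ fold ★ `F0P3StubE2pFold.hodgeTypeRigid_of_cohArchComponentRigid_cpt` instantiates β
(`Rogawski1990.cohArchComponentRigid`) ONLY at `(δ, δ′) = (1, −1)` and immediately contradicts the resulting `AreGKEquivalent` by ★
`hol_antihol_inequivalent_of_irreducible`.  CONTRACT v6 therefore shrinks β to **β_opp** = β's text token for token up to the `T₂` line, then
`upqTypeClasses σK σ𝔤 hM.ad_compat 1 1 ≠ ⊥ → upqTypeClasses σK' σ𝔤' hM'.ad_compat 1 (-1) ≠ ⊥ → False` («opposite-sign cohomological archimedean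
constituents never sit over a common finite component σ», [Rogawski1990 13.3.6 (c) + 13.3.5 ∕ 14.6.4 l.1 + 15.2.1 sign]).

* `hodgeTypeRigid_of_betaOpp_of_F1a_cpt` — E2′ from β_opp + F1a (hol) + F1a (antihol) + the two value-map heads: ★
  `hodgeTypeRigid_of_cohArchComponentRigid_cpt`'s proof VERBATIM with its last two steps replaced by `(hβo … hne hne').elim`.
* **`hodgeTypeRigid_of_betaOpp_cpt (hβo : <β_opp text VERBATIM>) (hF1a : <StubF1aCM[v5] text VERBATIM>) : Rogawski1990.hodgeTypeRigid`** — the line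
  fold of ED.2.7: `stub_E2p := F0P3StubBetaOppFold.hodgeTypeRigid_of_betaOpp_cpt stub_betaOpp stub_F1a_cm`.
* `betaOpp_of_beta (hβ : cohArchComponentRigid) : <β_opp text>` — v6 ≤ v5 (the sketch's 4-line proof).

No definition, no `sorry`, no named fact asserted (β and E2′ appear only as hypothesis ∕ conclusion BY NAME); `--supports stmt-HodgeConjecture-24833`.
-/

-- Mathlib idiom (as in ★ `GKModules` and ★ `F0P3StubE2pFold`): commutator bracket on `Module.End ℂ V`
attribute [local instance 100] LieRing.ofAssociativeRing

set_option autoImplicit false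
set_option linter.dupNamespace false

noncomputable section

namespace Summit.HodgeConjecture.HodgeConjecture.Cruxes.H413.F0P3StubBetaOppFold

open NumberField NumberField.InfinitePlace MeasureTheory
open scoped Matrix MatrixGroups ComplexOrder
open Literature.RepresentationTheory.BorelWallach2000
open Literature.NumberTheory.Automorphic Literature.NumberTheory.Automorphic.UnitaryGroup
open Literature.NumberTheory.Automorphic.UnitaryGroup.CotangentForms
open Literature.RepresentationTheory.KonnoKonno2007 Literature.RepresentationTheory.KonnoKonno2007.RealDualPair
open Literature.RepresentationTheory.KonnoKonno2007.RealDualPair.UForm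
open Summit.HodgeConjecture.HodgeConjecture.Cruxes.H413.F0P3HodgeTypeRigidOfArchRigid
open Summit.HodgeConjecture.HodgeConjecture.Cruxes.H413.F0P3HodgeTypeRigidDiag
open Summit.HodgeConjecture.HodgeConjecture.Cruxes.H413.F0P3ValueMapHeads
open Summit.HodgeConjecture.HodgeConjecture.Cruxes.H413.F0P3ArchIsotypyCM
open Summit.HodgeConjecture.HodgeConjecture.Cruxes.H413.F0P3ValueMapTransport
open Summit.HodgeConjecture.HodgeConjecture.Cruxes.H413.F0P3PNullMapIsCocycle
open Summit.HodgeConjecture.HodgeConjecture.Cruxes.H413.F0P3bArchDegOnePackage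
open Summit.HodgeConjecture.HodgeConjecture.Cruxes.H413.F0P3StubE2pFold

/-- **E2′ ⇐ β_opp + F1a (hol) + F1a (antihol) + value maps** (COMPACT-QUOTIENT form, CONTRACT v6): ★ `hodgeTypeRigid_of_cohArchComponentRigid_cpt`'s
proof with β replaced by its consumed instance β_opp — the detected irreducible `M` (type `+1` class from the hol value map of `P`) and `M′` (type `−1`
class from the antihol value map of `P′`) over the common finite component `σ` contradict β_opp directly.
[cite: Rogawski1990, Thm. 13.3.6 (c); Thm. 13.3.5; §14.6 Thm. 14.6.4; Prop. 15.2.1 (b); §15.3 ¶1] [cite: BorelWallach2000, VI Thm. 4.11] [cite: FlathCorvallis1979, Thm. 3] -/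
theorem hodgeTypeRigid_of_betaOpp_of_F1a_cpt
    (hβo :
    ∀ (L : Type) [Field L] [NumberField L] [IsCMField L] (ι : L →+* ℂ) (H : Matrix (Fin 3) (Fin 3) L) (T : GL (Fin 3) ℂ)
      (hT : (T : Matrix (Fin 3) (Fin 3) ℂ)ᴴ * H.map ι * (T : Matrix (Fin 3) (Fin 3) ℂ) = Literature.Geometry.ComplexHyperbolic.BallModel.J),
      (∀ τ' : L →+* ℂ, InfinitePlace.mk τ' ≠ InfinitePlace.mk ι → (H.map τ').PosDef) →
      2 ≤ Module.finrank ℚ ↥(maximalRealSubfield L) →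
      ∀ (μ : Measure (adelicGroupData (↥(maximalRealSubfield L)) L (IsCMField.complexConj L) 3 H).automorphicQuotient)
        [(adelicGroupData (↥(maximalRealSubfield L)) L (IsCMField.complexConj L) 3 H).IsAutomorphicMeasure μ]
        (W : Type) [AddCommGroup W] [Module ℂ W]
        (σ : Representation ℂ (finAdelic (↥(maximalRealSubfield L)) L (IsCMField.complexConj L) 3 H) W),
        σ.IsIrreducible → σ.IsSmooth →
      ∀ (P P' : DiscreteAutomorphicRep (adelicGroupData (↥(maximalRealSubfield L)) L (IsCMField.complexConj L) 3 H) μ),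
        P.HasFinComponent σ → P'.HasFinComponent σ →
      ∀ (M : Type) [AddCommGroup M] [Module ℂ M] (σK : Representation ℂ (uFormGroup (Fin 2) (Fin 1)).maximalCompact M)
        (σ𝔤 : (uFormGroup (Fin 2) (Fin 1)).lie →ₗ⁅ℝ⁆ Module.End ℂ M) (hM : IsGKModule (uFormGroup (Fin 2) (Fin 1)) σK σ𝔤),
        IsIrreducibleGK σK σ𝔤 →
        (∃ T₁ : P.archModuleCM ι T hT →ₗ[ℂ] M,
          (∀ (k : (uFormGroup (Fin 2) (Fin 1)).maximalCompact) (w : P.archModuleCM ι T hT),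
              T₁ (P.archRepKCM ι T hT k w) = σK k (T₁ w)) ∧
            (∀ (X : (uFormGroup (Fin 2) (Fin 1)).lie) (w : P.archModuleCM ι T hT),
              T₁ (P.archRepLieCM ι T hT X w) = σ𝔤 X (T₁ w)) ∧ T₁ ≠ 0) →
      ∀ (M' : Type) [AddCommGroup M'] [Module ℂ M'] (σK' : Representation ℂ (uFormGroup (Fin 2) (Fin 1)).maximalCompact M')
        (σ𝔤' : (uFormGroup (Fin 2) (Fin 1)).lie →ₗ⁅ℝ⁆ Module.End ℂ M') (hM' : IsGKModule (uFormGroup (Fin 2) (Fin 1)) σK' σ𝔤'),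
        IsIrreducibleGK σK' σ𝔤' →
        (∃ T₂ : P'.archModuleCM ι T hT →ₗ[ℂ] M',
          (∀ (k : (uFormGroup (Fin 2) (Fin 1)).maximalCompact) (w : P'.archModuleCM ι T hT),
              T₂ (P'.archRepKCM ι T hT k w) = σK' k (T₂ w)) ∧
            (∀ (X : (uFormGroup (Fin 2) (Fin 1)).lie) (w : P'.archModuleCM ι T hT),
              T₂ (P'.archRepLieCM ι T hT X w) = σ𝔤' X (T₂ w)) ∧ T₂ ≠ 0) →
        upqTypeClasses σK σ𝔤 hM.ad_compat 1 1 ≠ ⊥ → upqTypeClasses σK' σ𝔤' hM'.ad_compat 1 (-1) ≠ ⊥ → False)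
    (hF1a : ∀ (L : Type) [Field L] [NumberField L] [IsCMField L] (ι : L →+* ℂ) (H : Matrix (Fin 3) (Fin 3) L) (T : GL (Fin 3) ℂ)
      (hT : (T : Matrix (Fin 3) (Fin 3) ℂ)ᴴ * H.map ι * (T : Matrix (Fin 3) (Fin 3) ℂ) = Literature.Geometry.ComplexHyperbolic.BallModel.J),
      (∀ τ' : L →+* ℂ, InfinitePlace.mk τ' ≠ InfinitePlace.mk ι → (H.map τ').PosDef) →
      2 ≤ Module.finrank ℚ ↥(maximalRealSubfield L) →
      ∀ (μ : Measure (adelicGroupData (↥(maximalRealSubfield L)) L (IsCMField.complexConj L) 3 H).automorphicQuotient)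
      [(adelicGroupData (↥(maximalRealSubfield L)) L (IsCMField.complexConj L) 3 H).IsAutomorphicMeasure μ]
      (P : DiscreteAutomorphicRep (adelicGroupData (↥(maximalRealSubfield L)) L (IsCMField.complexConj L) 3 H) μ),
      P.IsHolCotangentAt (cmArchSection L ι H T hT) (cmCompactFactor L ι H T hT) →
      P.ArchIsotypy (uFormGroup (Fin 2) (Fin 1)) (cmArchSectionUForm L ι H T hT))
    (hF1a' : ∀ (L : Type) [Field L] [NumberField L] [IsCMField L] (ι : L →+* ℂ) (H : Matrix (Fin 3) (Fin 3) L) (T : GL (Fin 3) ℂ)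
      (hT : (T : Matrix (Fin 3) (Fin 3) ℂ)ᴴ * H.map ι * (T : Matrix (Fin 3) (Fin 3) ℂ) = Literature.Geometry.ComplexHyperbolic.BallModel.J),
      (∀ τ' : L →+* ℂ, InfinitePlace.mk τ' ≠ InfinitePlace.mk ι → (H.map τ').PosDef) →
      2 ≤ Module.finrank ℚ ↥(maximalRealSubfield L) →
      ∀ (μ : Measure (adelicGroupData (↥(maximalRealSubfield L)) L (IsCMField.complexConj L) 3 H).automorphicQuotient)
      [(adelicGroupData (↥(maximalRealSubfield L)) L (IsCMField.complexConj L) 3 H).IsAutomorphicMeasure μ]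
      (P : DiscreteAutomorphicRep (adelicGroupData (↥(maximalRealSubfield L)) L (IsCMField.complexConj L) 3 H) μ),
      P.IsAntiholCotangentAt (cmArchSection L ι H T hT) (cmCompactFactor L ι H T hT) →
      P.ArchIsotypy (uFormGroup (Fin 2) (Fin 1)) (cmArchSectionUForm L ι H T hT))
    (hVal : ∀ (L : Type) [Field L] [NumberField L] [IsCMField L] (ι : L →+* ℂ) (H : Matrix (Fin 3) (Fin 3) L) (T : GL (Fin 3) ℂ)
      (hT : (T : Matrix (Fin 3) (Fin 3) ℂ)ᴴ * H.map ι * (T : Matrix (Fin 3) (Fin 3) ℂ) = Literature.Geometry.ComplexHyperbolic.BallModel.J),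
      (∀ τ' : L →+* ℂ, InfinitePlace.mk τ' ≠ InfinitePlace.mk ι → (H.map τ').PosDef) →
      2 ≤ Module.finrank ℚ ↥(maximalRealSubfield L) →
      ∀ (μ : Measure (adelicGroupData (↥(maximalRealSubfield L)) L (IsCMField.complexConj L) 3 H).automorphicQuotient)
      [(adelicGroupData (↥(maximalRealSubfield L)) L (IsCMField.complexConj L) 3 H).IsAutomorphicMeasure μ]
      (P : DiscreteAutomorphicRep (adelicGroupData (↥(maximalRealSubfield L)) L (IsCMField.complexConj L) 3 H) μ)
      (Φ : (adelicGroupData (↥(maximalRealSubfield L)) L (IsCMField.complexConj L) 3 H).Adelic → (Fin 2 → ℂ)),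
      Φ ∈ CotangentForms.holCotForms (↥(maximalRealSubfield L)) L (IsCMField.complexConj L) 3 H (cmArchSection L ι H T hT)
        (cmCompactFactor L ι H T hT) → Φ ≠ 0 → P.ContainsForm Φ →
      ∃ φ : (uFormGroup (Fin 2) (Fin 1)).lie →ₗ[ℝ] P.archModuleCM ι T hT, φ ≠ 0 ∧
        (∀ W ∈ (uFormGroup (Fin 2) (Fin 1)).kInLie, φ W = 0) ∧
        (∀ (k : (uFormGroup (Fin 2) (Fin 1)).maximalCompact) (X : (uFormGroup (Fin 2) (Fin 1)).lie),
          P.archRepKCM ι T hT k (φ X) =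
            φ ((uFormGroup (Fin 2) (Fin 1)).Ad (Subgroup.inclusion (uFormGroup (Fin 2) (Fin 1)).maximalCompact_le_carrier k) X)) ∧
        (∀ W ∈ (uFormGroup (Fin 2) (Fin 1)).kInLie, ∀ X : (uFormGroup (Fin 2) (Fin 1)).lie,
          φ ⁅W, X⁆ = P.archRepLieCM ι T hT W (φ X)) ∧
        (∀ X : (uFormGroup (Fin 2) (Fin 1)).lie, P.archRepLieCM ι T hT (upqZ0 (Fin 2) (Fin 1)) (φ X) = Complex.I • φ X) ∧
        (∀ (X : (uFormGroup (Fin 2) (Fin 1)).lie) (s : (Fin 2 × Fin 1) × Fin 2),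
          P.archRepLieCM ι T hT (upqPBasis s) (φ X) +
            Complex.I • P.archRepLieCM ι T hT ⁅upqZ0 (Fin 2) (Fin 1), upqPBasis s⁆ (φ X) = 0))
    (hVal' : ∀ (L : Type) [Field L] [NumberField L] [IsCMField L] (ι : L →+* ℂ) (H : Matrix (Fin 3) (Fin 3) L) (T : GL (Fin 3) ℂ)
      (hT : (T : Matrix (Fin 3) (Fin 3) ℂ)ᴴ * H.map ι * (T : Matrix (Fin 3) (Fin 3) ℂ) = Literature.Geometry.ComplexHyperbolic.BallModel.J),
      (∀ τ' : L →+* ℂ, InfinitePlace.mk τ' ≠ InfinitePlace.mk ι → (H.map τ').PosDef) →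
      2 ≤ Module.finrank ℚ ↥(maximalRealSubfield L) →
      ∀ (μ : Measure (adelicGroupData (↥(maximalRealSubfield L)) L (IsCMField.complexConj L) 3 H).automorphicQuotient)
      [(adelicGroupData (↥(maximalRealSubfield L)) L (IsCMField.complexConj L) 3 H).IsAutomorphicMeasure μ]
      (P : DiscreteAutomorphicRep (adelicGroupData (↥(maximalRealSubfield L)) L (IsCMField.complexConj L) 3 H) μ)
      (Ψ : (adelicGroupData (↥(maximalRealSubfield L)) L (IsCMField.complexConj L) 3 H).Adelic → (Fin 2 → ℂ)),
      Ψ ∈ (CotangentForms.holCotForms (↥(maximalRealSubfield L)) L (IsCMField.complexConj L) 3 H (cmArchSection L ι H T hT)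
        (cmCompactFactor L ι H T hT)).map (CotangentForms.conjFun (↥(maximalRealSubfield L)) L (IsCMField.complexConj L) 3 H) →
        Ψ ≠ 0 → P.ContainsForm Ψ →
      ∃ φ : (uFormGroup (Fin 2) (Fin 1)).lie →ₗ[ℝ] P.archModuleCM ι T hT, φ ≠ 0 ∧
        (∀ W ∈ (uFormGroup (Fin 2) (Fin 1)).kInLie, φ W = 0) ∧
        (∀ (k : (uFormGroup (Fin 2) (Fin 1)).maximalCompact) (X : (uFormGroup (Fin 2) (Fin 1)).lie),
          P.archRepKCM ι T hT k (φ X) =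
            φ ((uFormGroup (Fin 2) (Fin 1)).Ad (Subgroup.inclusion (uFormGroup (Fin 2) (Fin 1)).maximalCompact_le_carrier k) X)) ∧
        (∀ W ∈ (uFormGroup (Fin 2) (Fin 1)).kInLie, ∀ X : (uFormGroup (Fin 2) (Fin 1)).lie,
          φ ⁅W, X⁆ = P.archRepLieCM ι T hT W (φ X)) ∧
        (∀ X : (uFormGroup (Fin 2) (Fin 1)).lie, P.archRepLieCM ι T hT (upqZ0 (Fin 2) (Fin 1)) (φ X) = (-Complex.I) • φ X) ∧
        (∀ (X : (uFormGroup (Fin 2) (Fin 1)).lie) (s : (Fin 2 × Fin 1) × Fin 2),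
          P.archRepLieCM ι T hT (upqPBasis s) (φ X) +
            (-Complex.I) • P.archRepLieCM ι T hT ⁅upqZ0 (Fin 2) (Fin 1), upqPBasis s⁆ (φ X) = 0)) :
    Literature.NumberTheory.Rogawski1990.hodgeTypeRigid := by
  intro L _ _ _ ι H T hT hdef h2 μ _ W _ _ σ hirr hsm P P' hP hP' hfin hfin'
  -- letter F1a at the pin, for the hol-type `P` and the antihol-type `P′`
  have hIso := hF1a L ι H T hT hdef h2 μ P hP
  have hIso' := hF1a' L ι H T hT hdef h2 μ P' hP'
  -- the cotangent forms and their value maps (B1′)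
  obtain ⟨Φ, hΦ, hΦ0, hcont⟩ := hP
  obtain ⟨Ψ, hΨ, hΨ0, hcont'⟩ := hP'
  obtain ⟨φ, hφ0, h0, hK, h𝔨, hwt, hN⟩ := hVal L ι H T hT hdef h2 μ P Φ hΦ hΦ0 hcont
  obtain ⟨φ', hφ'0, h0', hK', h𝔨', hwt', hN'⟩ := hVal' L ι H T hT hdef h2 μ P' Ψ hΨ hΨ0 hcont'
  -- the detecting irreducible admissible modules (F1a unpacked at the pin) and detecting maps
  obtain ⟨M, _, _, σK, σ𝔤, hGK, hirrM, -, hdet⟩ := exists_detecting_irreducible ι T hT P hIso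
  obtain ⟨M', _, _, σK', σ𝔤', hGK', hirrM', -, hdet'⟩ := exists_detecting_irreducible ι T hT P' hIso'
  obtain ⟨X₀, hX₀⟩ := exists_apply_ne_zero_of_ne_zero hφ0
  obtain ⟨X₁, hX₁⟩ := exists_apply_ne_zero_of_ne_zero hφ'0
  obtain ⟨T₁, hT₁K, hT₁𝔤, hT₁⟩ := hdet _ hX₀
  obtain ⟨T₂, hT₂K, hT₂𝔤, hT₂⟩ := hdet' _ hX₁
  have hT₁0 : T₁ ≠ 0 := fun h => hT₁ (h ▸ rfl)
  have hT₂0 : T₂ ≠ 0 := fun h => hT₂ (h ▸ rfl)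
  -- typed value maps on `M`, `M′` and the cohomology classes they give
  have c1 : ((1 : ℤ) : ℂ) = 1 := Int.cast_one
  have c2 : ((-1 : ℤ) : ℂ) = -1 := by rw [Int.cast_neg, Int.cast_one]
  obtain ⟨q0, qK, q𝔨, qwt, qN⟩ := valueMap_comp (δ := 1) φ T₁ hT₁K hT₁𝔤 h0 hK h𝔨
    (fun X => eq_intCast_mul_I_smul_of_eq_one (V := ↥(P.archModuleCM ι T hT)) c1 (hwt X))
    (fun X s => add_intCast_mul_I_smul_eq_zero_of_eq_one (V := ↥(P.archModuleCM ι T hT)) c1 (hN X s))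
  obtain ⟨r0, rK, r𝔨, rwt, rN⟩ := valueMap_comp (δ := -1) φ' T₂ hT₂K hT₂𝔤 h0' hK' h𝔨'
    (fun X => eq_intCast_mul_I_smul_of_eq_neg_one (V := ↥(P'.archModuleCM ι T hT)) c2 (hwt' X))
    (fun X s => add_intCast_mul_I_smul_eq_zero_of_eq_neg_one (V := ↥(P'.archModuleCM ι T hT)) c2 (hN' X s))
  have hne : upqTypeClasses σK σ𝔤 hGK.ad_compat 1 1 ≠ ⊥ :=
    typeClasses_ne_bot_of_linearMap σK σ𝔤 hGK.ad_compat hirrM (Or.inl rfl) _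
      (comp_ne_zero_of_apply_ne_zero φ T₁ hT₁) q0 qK q𝔨 qwt qN
  have hne' : upqTypeClasses σK' σ𝔤' hGK'.ad_compat 1 (-1) ≠ ⊥ :=
    typeClasses_ne_bot_of_linearMap σK' σ𝔤' hGK'.ad_compat hirrM' (Or.inr rfl) _
      (comp_ne_zero_of_apply_ne_zero φ' T₂ hT₂) r0 rK r𝔨 rwt rN
  -- β_opp: the type-`(+1)` constituent of `P` and the type-`(−1)` constituent of `P′` cannot coexist over `σ`
  exact (hβo L ι H T hT hdef h2 μ W σ hirr hsm P P' hfin hfin' M σK σ𝔤 hGK hirrM ⟨T₁, hT₁K, hT₁𝔤, hT₁0⟩ M' σK' σ𝔤' hGK' hirrM'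
    ⟨T₂, hT₂K, hT₂𝔤, hT₂0⟩ hne hne').elim

/-- **`stub_E2p` CLOSER, CONTRACT v6: letter E2′ `hodgeTypeRigid` from β_opp and `StubF1aCM` in its v5 text** (F1a at the CM pin for
hol-∕antihol-type `P` of a compact-quotient datum).  Line fold (ED.2.7): `stub_E2p := hodgeTypeRigid_of_betaOpp_cpt stub_betaOpp stub_F1a_cm`.
[cite: Rogawski1990, Thm. 13.3.6 (c); Thm. 13.3.5; §14.6 Thm. 14.6.4; Prop. 15.2.1 (b); §15.3 ¶1] [cite: BorelWallach2000, VI Thm. 4.11] [cite: FlathCorvallis1979, Thm. 3] -/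
theorem hodgeTypeRigid_of_betaOpp_cpt
    (hβo :
    ∀ (L : Type) [Field L] [NumberField L] [IsCMField L] (ι : L →+* ℂ) (H : Matrix (Fin 3) (Fin 3) L) (T : GL (Fin 3) ℂ)
      (hT : (T : Matrix (Fin 3) (Fin 3) ℂ)ᴴ * H.map ι * (T : Matrix (Fin 3) (Fin 3) ℂ) = Literature.Geometry.ComplexHyperbolic.BallModel.J),
      (∀ τ' : L →+* ℂ, InfinitePlace.mk τ' ≠ InfinitePlace.mk ι → (H.map τ').PosDef) →
      2 ≤ Module.finrank ℚ ↥(maximalRealSubfield L) →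
      ∀ (μ : Measure (adelicGroupData (↥(maximalRealSubfield L)) L (IsCMField.complexConj L) 3 H).automorphicQuotient)
        [(adelicGroupData (↥(maximalRealSubfield L)) L (IsCMField.complexConj L) 3 H).IsAutomorphicMeasure μ]
        (W : Type) [AddCommGroup W] [Module ℂ W]
        (σ : Representation ℂ (finAdelic (↥(maximalRealSubfield L)) L (IsCMField.complexConj L) 3 H) W),
        σ.IsIrreducible → σ.IsSmooth →
      ∀ (P P' : DiscreteAutomorphicRep (adelicGroupData (↥(maximalRealSubfield L)) L (IsCMField.complexConj L) 3 H) μ),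
        P.HasFinComponent σ → P'.HasFinComponent σ →
      ∀ (M : Type) [AddCommGroup M] [Module ℂ M] (σK : Representation ℂ (uFormGroup (Fin 2) (Fin 1)).maximalCompact M)
        (σ𝔤 : (uFormGroup (Fin 2) (Fin 1)).lie →ₗ⁅ℝ⁆ Module.End ℂ M) (hM : IsGKModule (uFormGroup (Fin 2) (Fin 1)) σK σ𝔤),
        IsIrreducibleGK σK σ𝔤 →
        (∃ T₁ : P.archModuleCM ι T hT →ₗ[ℂ] M,
          (∀ (k : (uFormGroup (Fin 2) (Fin 1)).maximalCompact) (w : P.archModuleCM ι T hT),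
              T₁ (P.archRepKCM ι T hT k w) = σK k (T₁ w)) ∧
            (∀ (X : (uFormGroup (Fin 2) (Fin 1)).lie) (w : P.archModuleCM ι T hT),
              T₁ (P.archRepLieCM ι T hT X w) = σ𝔤 X (T₁ w)) ∧ T₁ ≠ 0) →
      ∀ (M' : Type) [AddCommGroup M'] [Module ℂ M'] (σK' : Representation ℂ (uFormGroup (Fin 2) (Fin 1)).maximalCompact M')
        (σ𝔤' : (uFormGroup (Fin 2) (Fin 1)).lie →ₗ⁅ℝ⁆ Module.End ℂ M') (hM' : IsGKModule (uFormGroup (Fin 2) (Fin 1)) σK' σ𝔤'),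
        IsIrreducibleGK σK' σ𝔤' →
        (∃ T₂ : P'.archModuleCM ι T hT →ₗ[ℂ] M',
          (∀ (k : (uFormGroup (Fin 2) (Fin 1)).maximalCompact) (w : P'.archModuleCM ι T hT),
              T₂ (P'.archRepKCM ι T hT k w) = σK' k (T₂ w)) ∧
            (∀ (X : (uFormGroup (Fin 2) (Fin 1)).lie) (w : P'.archModuleCM ι T hT),
              T₂ (P'.archRepLieCM ι T hT X w) = σ𝔤' X (T₂ w)) ∧ T₂ ≠ 0) →
        upqTypeClasses σK σ𝔤 hM.ad_compat 1 1 ≠ ⊥ → upqTypeClasses σK' σ𝔤' hM'.ad_compat 1 (-1) ≠ ⊥ → False)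
    (hF1a : ∀ (L : Type) [Field L] [NumberField L] [IsCMField L] (ι : L →+* ℂ) (H : Matrix (Fin 3) (Fin 3) L) (T : GL (Fin 3) ℂ)
      (hT : (T : Matrix (Fin 3) (Fin 3) ℂ)ᴴ * H.map ι * (T : Matrix (Fin 3) (Fin 3) ℂ) = Literature.Geometry.ComplexHyperbolic.BallModel.J),
      (∀ τ' : L →+* ℂ, InfinitePlace.mk τ' ≠ InfinitePlace.mk ι → (H.map τ').PosDef) →
      2 ≤ Module.finrank ℚ ↥(maximalRealSubfield L) →
      ∀ (μ : Measure (adelicGroupData (↥(maximalRealSubfield L)) L (IsCMField.complexConj L) 3 H).automorphicQuotient)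
      [(adelicGroupData (↥(maximalRealSubfield L)) L (IsCMField.complexConj L) 3 H).IsAutomorphicMeasure μ]
      (P : DiscreteAutomorphicRep (adelicGroupData (↥(maximalRealSubfield L)) L (IsCMField.complexConj L) 3 H) μ),
      (P.IsHolCotangentAt (cmArchSection L ι H T hT) (cmCompactFactor L ι H T hT) ∨
        P.IsAntiholCotangentAt (cmArchSection L ι H T hT) (cmCompactFactor L ι H T hT)) →
      P.ArchIsotypy (uFormGroup (Fin 2) (Fin 1)) (cmArchSectionUForm L ι H T hT)) :
    Literature.NumberTheory.Rogawski1990.hodgeTypeRigid :=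
  hodgeTypeRigid_of_betaOpp_of_F1a_cpt hβo
    (fun L _ _ _ ι H T hT hdef h2 μ _ P hP => hF1a L ι H T hT hdef h2 μ P (Or.inl hP))
    (fun L _ _ _ ι H T hT hdef h2 μ _ P hP => hF1a L ι H T hT hdef h2 μ P (Or.inr hP))
    hVal_hol hVal_antihol

/-- **v6 ≤ v5: β ⇒ β_opp** (instantiate β at `(δ, δ′) = (1, −1)`; ★ purity `hol_antihol_inequivalent_of_irreducible`).  The planner's sketch proof.
[cite: Rogawski1990, Thm. 13.3.6 (c); Prop. 15.2.1 (b)] [cite: BorelWallach2000, VI Thm. 4.11 (3)] -/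
theorem betaOpp_of_beta (hβ : Literature.NumberTheory.Rogawski1990.cohArchComponentRigid) :
    ∀ (L : Type) [Field L] [NumberField L] [IsCMField L] (ι : L →+* ℂ) (H : Matrix (Fin 3) (Fin 3) L) (T : GL (Fin 3) ℂ)
      (hT : (T : Matrix (Fin 3) (Fin 3) ℂ)ᴴ * H.map ι * (T : Matrix (Fin 3) (Fin 3) ℂ) = Literature.Geometry.ComplexHyperbolic.BallModel.J),
      (∀ τ' : L →+* ℂ, InfinitePlace.mk τ' ≠ InfinitePlace.mk ι → (H.map τ').PosDef) →
      2 ≤ Module.finrank ℚ ↥(maximalRealSubfield L) →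
      ∀ (μ : Measure (adelicGroupData (↥(maximalRealSubfield L)) L (IsCMField.complexConj L) 3 H).automorphicQuotient)
        [(adelicGroupData (↥(maximalRealSubfield L)) L (IsCMField.complexConj L) 3 H).IsAutomorphicMeasure μ]
        (W : Type) [AddCommGroup W] [Module ℂ W]
        (σ : Representation ℂ (finAdelic (↥(maximalRealSubfield L)) L (IsCMField.complexConj L) 3 H) W),
        σ.IsIrreducible → σ.IsSmooth →
      ∀ (P P' : DiscreteAutomorphicRep (adelicGroupData (↥(maximalRealSubfield L)) L (IsCMField.complexConj L) 3 H) μ),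
        P.HasFinComponent σ → P'.HasFinComponent σ →
      ∀ (M : Type) [AddCommGroup M] [Module ℂ M] (σK : Representation ℂ (uFormGroup (Fin 2) (Fin 1)).maximalCompact M)
        (σ𝔤 : (uFormGroup (Fin 2) (Fin 1)).lie →ₗ⁅ℝ⁆ Module.End ℂ M) (hM : IsGKModule (uFormGroup (Fin 2) (Fin 1)) σK σ𝔤),
        IsIrreducibleGK σK σ𝔤 →
        (∃ T₁ : P.archModuleCM ι T hT →ₗ[ℂ] M,
          (∀ (k : (uFormGroup (Fin 2) (Fin 1)).maximalCompact) (w : P.archModuleCM ι T hT),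
              T₁ (P.archRepKCM ι T hT k w) = σK k (T₁ w)) ∧
            (∀ (X : (uFormGroup (Fin 2) (Fin 1)).lie) (w : P.archModuleCM ι T hT),
              T₁ (P.archRepLieCM ι T hT X w) = σ𝔤 X (T₁ w)) ∧ T₁ ≠ 0) →
      ∀ (M' : Type) [AddCommGroup M'] [Module ℂ M'] (σK' : Representation ℂ (uFormGroup (Fin 2) (Fin 1)).maximalCompact M')
        (σ𝔤' : (uFormGroup (Fin 2) (Fin 1)).lie →ₗ⁅ℝ⁆ Module.End ℂ M') (hM' : IsGKModule (uFormGroup (Fin 2) (Fin 1)) σK' σ𝔤'),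
        IsIrreducibleGK σK' σ𝔤' →
        (∃ T₂ : P'.archModuleCM ι T hT →ₗ[ℂ] M',
          (∀ (k : (uFormGroup (Fin 2) (Fin 1)).maximalCompact) (w : P'.archModuleCM ι T hT),
              T₂ (P'.archRepKCM ι T hT k w) = σK' k (T₂ w)) ∧
            (∀ (X : (uFormGroup (Fin 2) (Fin 1)).lie) (w : P'.archModuleCM ι T hT),
              T₂ (P'.archRepLieCM ι T hT X w) = σ𝔤' X (T₂ w)) ∧ T₂ ≠ 0) →
        upqTypeClasses σK σ𝔤 hM.ad_compat 1 1 ≠ ⊥ → upqTypeClasses σK' σ𝔤' hM'.ad_compat 1 (-1) ≠ ⊥ → False := by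
  intro L _ _ _ ι H T hT hdef h2 μ _ W _ _ σ hirr hsm P P' hfin hfin' M _ _ σK σ𝔤 hM hirrM hT₁ M' _ _ σK' σ𝔤' hM' hirrM' hT₂
    hne hne'
  exact hol_antihol_inequivalent_of_irreducible hM hM' hirrM' hne hne'
    (hβ L ι H T hT hdef h2 μ W σ hirr hsm P P' hfin hfin' M σK σ𝔤 hM hirrM hT₁ M' σK' σ𝔤' hM' hirrM' hT₂ 1 (-1)
      (Or.inl rfl) (Or.inr rfl) hne hne')

end Summit.HodgeConjecture.HodgeConjecture.Cruxes.H413.F0P3StubBetaOppFold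

end
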